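import Literature.MathematicalPhysics.QuantumFieldTheory.Balaban1983to89.B8Eq1123Concrete
import Literature.MathematicalPhysics.QuantumFieldTheory.Balaban1983to89.B8Ineq125

/-!
# `Balaban1983to89.B8Ineq125Concrete` — T. Bałaban, *Spaces of regular gauge field configurations on a lattice and gauge
# fixing conditions*, Commun. Math. Phys. **99** (1985) 75–102 [Balaban1985RegularSpaces], Sect. E p. 97: the Cauchy formula
# (1.124) and the estimate (1.125) FOR THE CONCRETE REMAINDER `C′ = C′_j(u₁, ·)` of (213) [3] on the `ℤᵈ` carriers of the lineage

statement-level skeleton of published theorems with citation tags; proofs where landed; nothing here is a claim about the Yang–Mills mass gap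

PDF held: `paper:balaban1985-cmp99-regular-spaces-gauge-fixing` (journal page = PDF page + 74); pp. 96–97 read AS IMAGES on the
renders `run/shared/lean/pub/pub-balaban/b2b-balaban-ref1/pages/1985-cmp99-regular-spaces-gauge-fixing/…-p022-x2.png`, `…-p023-x2.png`
(this unit, 2026-08-21); [3] = T. Bałaban, *Averaging operations for lattice gauge theories*, Commun. Math. Phys. **98** (1985) 17–51
[Balaban1985Averaging], (207)–(208), (213)–(214) p. 50 (held: `paper:balaban1985-cmp98-averaging`).

CITATION HEADER (lean-in-tree rule).  Cell `lit-balaban` (HOME `run/shared/lean/pub/lit-balaban/`), unit `lit-balaban-p05` (Phase-2 proof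
seat p05, gen 5; TAKING line HOME/STATUS.md 2026-08-21T06:31Z; free-target protocol G.5-34(d); owner of block B8 = `lit-balaban-r05`,
referee ref-4).  WHAT IS REPRODUCED = SKELETON row **`B8.Eq1.125`** ((1.122)–(1.125) pp. 96–97), members (1.124)–(1.125), hitherto
`proved-existing` ONLY AT THE ABSTRACT LEVEL — `B8Ineq125` proves the radius arithmetic (`radius_keeps_domain`), the Cauchy estimate for
an ARBITRARY `DiffContOnCl` function `f : ℂ → F` (`cauchy_weighted`) and the constants (`ineq125_weighted`), taking «the analyticity
properties of `C′(λ)`» and «the inequality (214)» as hypotheses.  HERE those hypotheses are DISCHARGED for the lattice object itself, the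
remainder `C′_j(u₁, λ) := Q′_j(u₁, λ) − Q′_jλ` = `B8Eq1123Concrete.Cnl` (file 1 of this series: analyticity from r04's `B7Eq208Analytic`,
(208) [3]; (1.123) `dCnl` and its linearity; the radius lemma `line_mem_dom207`), the sphere bound being (1.121) = r05's
`B8Eq178Averages.eq214_qprimeIter_of207` ((213)–(214) [3]) at a GENERAL background `U₀` with (52), on the ONE-LEVEL (207)-domain of [3]
(READING (b)).  File 3 `B8Eq1122Concrete` (same unit): (1.122) and the displayed Lipschitz bound.

PRINT (p. 97 [PDF 23], verbatim; (1.122)–(1.123) p. 96 are quoted in `B8Eq1123Concrete`).  «Using the analyticity properties of `C′(λ)`,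
the derivative above can be written as `⟨(δ/δλ)C′(λ), λ₀⟩ = (1/2πi) ∫_{|τ|=r} dτ (1/τ²) C′(λ + τλ₀)`. (1.124)  Taking
`r = (2max{|λ₀|, |Dλ₀|})⁻¹α₄`, we get the estimate `|⟨(δ/δλ)C′(λ), λ₀⟩| ≦ C′₂ 2max{|λ₀|, |Dλ₀|} (α₃ + α₄)`. (1.125)»  Inputs (p. 96):
(1.119) `|λ| < ½α₄, |Dλ| < ½α₄(Lʲη)⁻¹ on Ω_j`; (1.120) `|λ − H′X| < α₄, |D(λ − H′X)| < α₄(Lʲη)⁻¹ on Ω_j`; «and by the inequality (214) we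
have `|C′(λ − H′X)| < C′₂(α₃ + α₄)α₄`, (1.121) where the constant `O(1)` in (214) [3] was denoted by `C′₂`.»; «We may admit configurations
`λ, X` with values in the complexified algebra `𝔤ᶜ` and all the above equations and inequalities are valid also.»

WHAT THIS FILE PROVES (kernel, no `sorry`, standard axioms; carriers and data of `B8Eq1123Concrete`: `𝔸` a complete normed `ℂ`-algebra
with `‖1‖ = 1`, `U₀` `G`-valued (`G ⊂ U1` average-closed) with (52), `η = L⁻ᵏ`, `u₁ ∈ Λ_k(U₀, α₃)`, `λ, λ₀ : ℤᵈ → 𝔸`).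
* §0 `C2p d = 16·C′_gen` — the constant `C′₂` of (1.121) in the lineage's explicit (207)-form of (214) (`C2p_nonneg`).
* §5 `differentiableOn_Cnl_line` — on the closed disc `|τ| ≤ r = α₄/(2m)` the curve `τ ↦ C′_j(u₁, λ + τλ₀)(z)` is complex-differentiable
  (for `λ` in the half-size set (1.119) and `max{|λ₀|, |Dλ₀|} ≤ m`, `0 < m`): the `DiffContOnCl` input of `B8Ineq125.cauchy_weighted`,
  discharged.  **(1.124)** `eq1124` — `⟨δC′_j(u₁, λ), λ₀⟩(z) = (2πi)⁻¹ ∮_{|τ|=r} τ⁻² C′_j(u₁, λ + τλ₀)(z) dτ` (Mathlib's Cauchy formula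
  for the first derivative on the closed disc, `DifferentiableOn.deriv_eq_smul_circleIntegral`).  **(1.125)** `ineq1125` —
  `‖⟨δC′_j(u₁, λ), λ₀⟩(z)‖ ≤ C′₂·2m·(α₃ + α₄)·LʲL⁻ᵏ` (the factor `Lʲη ≤ 1` of (214) kept) and `ineq1125_printed` (`≤ C′₂·2m·(α₃ + α₄)`, the
  display), by `B8Ineq125.cauchy_weighted` BY NAME with the sphere bound `M = C′₂(α₃ + α₄)α₄·LʲL⁻ᵏ` = (1.121) supplied by
  `eq214_qprimeIter_of207` at the points `λ + τλ₀`, `|τ| = r` (which lie in (1.120) by `B8Eq1123Concrete.line_mem_dom207`).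
READINGS (recorded; none is an objection to print).  (a) `|·|` = the norm of `𝔸`; «`λ, X` with values in `𝔤ᶜ`» = all of `𝔸`;
`λ := log u′` (print's `i` absorbed, `B8Eq178Averages.Qnl`).  (b) DOMAINS: print's (1.119)/(1.120) are region-dependent (`|Dλ| <
½α₄(Lʲη)⁻¹ on Ω_j`, `j = 0, …, k`); the tree's concrete (214)/(208) are typed on the ONE-LEVEL (207)-domain of [3] (`|λ(x)| < α₄`,
`|(D^η_{U₀}λ)(b)| < α₄` at `η = L⁻ᵏ` on all bonds — the `Ω_k`-condition everywhere, the strongest of print's conditions), and so is this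
file; there the weight `Lᵏη = 1`, so print's UNWEIGHTED `max{|λ₀|, |Dλ₀|}` (`|Dλ₀| = sup_b|(D^η_{U₀}λ₀)(b)|`) is exactly the modulus that
works — the weighted repair recorded in `B8Ineq125` concerns the levels `j < k`, which do not occur in the one-level form.  (c) SMALLNESS
«`α₃, α₄` sufficiently small» = the hypotheses of `B8Eq178Averages.eq214_qprimeIter_of207` (`α₃ ≤ 1/200`, `200C₆α₄ ≤ 1`, `12·10³(d+1)Lα₄ ≤ 1`,
`C₄(α₀ + α₃ + 4α₄) ≤ 1`, the `α₀`-conditions of Propositions 2/10); they imply those of `B7Eq208Analytic.eq208_analyticAt_of207` used for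
(1.124).  (d) `max{…} ≤ m`, `0 < m` instead of `= max{…}` (a sup over the infinite lattice need not be attained; any upper bound gives print's
estimate with `m`).  NOT CLAIMED: the region-dependent form on `{Ω_j}`; print's unstated absolute constant `C′₂` (here `16·Cgen d`,
depending on `d` only).
DECLARATIONS: 1 definition with body (`C2p`), the rest theorems; no `… : Prop` fact is introduced.  REUSED BY NAME:
`B8Eq1123Concrete.Cnl, dCnl, line_mem_dom207, analyticAt_Cnl_family`, `B8Ineq125.cauchy_weighted`, `B8Eq178Averages.eq214_qprimeIter_of207`,
`B7Eq214General.Cgen`, `B7Prop10Flat.one_le_C5`, `B7Prop10General.C6`, Mathlib `DifferentiableOn.deriv_eq_smul_circleIntegral`,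
`DifferentiableOn.diffContOnCl_ball`.
Unit `lit-balaban-p05` (gen 5), 2026-08-21.

[cite: Balaban1985RegularSpaces, (1.124)–(1.125) p.97, (1.119)–(1.121) p.96; Balaban1985Averaging, (207)–(208) p.50, (213)–(214) p.50]
-/

noncomputable section

open NormedSpace Finset Metric Set
open scoped Real

namespace Literature.MathematicalPhysics.QuantumFieldTheory.Balaban1983to89.B8Ineq125Concrete

open B7Prop1Explicit B7Prop2Explicit MatrixLog B7Eq167Flat B7Prop9Flat B7Prop10General
open B7Prop10Flat (one_le_C5)
open B7Eq214General (Cgen)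
open B7Eq170Flat (cj)
open B8Eq178Averages (eq214_qprimeIter_of207)
open B8Eq1123Concrete (Cnl dCnl line_mem_dom207 analyticAt_Cnl_family)

-- `Site` alone would resolve to the torus sites of `Setup.lean`; re-export the `ℤ^d` sites of `B7Prop1Explicit`.
export B7Prop1Explicit (Site)

variable {d : ℕ}

/-! ## §0 The constant `C′₂` of (1.121) -/

/-- **`C′₂`** — «the constant `O(1)` in (214) [3] was denoted by `C′₂`» (1.121): in the lineage's explicit (207)-form of (214)
(`B8Eq178Averages.eq214_qprimeIter_of207`: `‖C′_j(u₁, λ)‖ ≤ 16C′_gen(α₃α₄ + α₄²)Lʲη`) it is `16·C′_gen`, `C′_gen = B7Eq214General.Cgen d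
= 8832(d+1)C₆`, depending on `d` only. [cite: Balaban1985RegularSpaces, (1.121) p.96; Balaban1985Averaging, (214) p.50] -/
def C2p (d : ℕ) : ℝ := 16 * Cgen d

/-- `0 ≤ C′₂`. [cite: Balaban1985RegularSpaces, (1.121) p.96] (elementary API; our proof) -/
theorem C2p_nonneg (d : ℕ) : 0 ≤ C2p d := by
  have hC6 : (2 : ℝ) ≤ C6 d := by unfold C6; linarith [one_le_C5 (d := d)]
  unfold C2p Cgen; positivity

/-! ## §5 (1.124) the Cauchy formula and (1.125) the estimate, for `C′_j(u₁, ·)` -/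

section Cauchy

variable {𝔸 : Type*} [NormedRing 𝔸] [NormOneClass 𝔸] [NormedAlgebra ℂ 𝔸] [CompleteSpace 𝔸]

/-- On the closed disc `|τ| ≤ r = α₄/(2m)` the curve `τ ↦ C′_j(u₁, λ + τλ₀)(z)` is complex-differentiable (for `λ` in (1.119) and
`max{|λ₀|, |Dλ₀|} ≤ m`): §2 puts `λ + τλ₀` in the (207)-domain and §3 gives analyticity there.  The `DiffContOnCl` input of
`B8Ineq125.cauchy_weighted`, discharged. [cite: Balaban1985RegularSpaces, (1.124) p.97] -/
theorem differentiableOn_Cnl_line {L : ℕ} (hL : 2 ≤ L) {G : Subgroup 𝔸ˣ} (hG : AvgClosed d L G) {U₀ : Site d → Fin d → 𝔸ˣ}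
    (hU : ∀ x κ, U₀ x κ ∈ G) {k : ℕ} {lam lam₀ : Site d → 𝔸} {m : ℝ}
    {u₁ : Site d → 𝔸ˣ} {α₀ α₃ α₄ : ℝ}
    (hα : 0 < α₀) (hα3 : C0 d * α₀ ≤ 1 / 3) (hα2 : 2 * α₀ ≤ c2' d L)
    (h52 : pdev U₀ < α₀ * (((L : ℝ) ^ k)⁻¹) ^ 2)
    (h119a : ∀ (x : Site d) (κ : Fin d), ‖cj (U₀ x κ) (lam (x + e κ)) - lam x‖ < α₄ / 2 * ((L : ℝ) ^ k)⁻¹)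
    (h119b : ∀ x : Site d, ‖lam x‖ < α₄ / 2)
    (hm₀a : ∀ (x : Site d) (κ : Fin d), ‖cj (U₀ x κ) (lam₀ (x + e κ)) - lam₀ x‖ ≤ m * ((L : ℝ) ^ k)⁻¹)
    (hm₀b : ∀ x : Site d, ‖lam₀ x‖ ≤ m) (hm : 0 < m)
    (hu₁ : InLambda L U₀ u₁ k α₃ (((L : ℝ) ^ k)⁻¹))
    (hα₃ : 0 ≤ α₃) (hα₃' : α₃ ≤ 1 / 50)
    (hs₁ : 40 * C6 d * α₄ ≤ 1) (hs₂ : 12000 * ((d : ℝ) + 1) * L * α₄ ≤ 1) (hs₃ : C4G d L * (α₀ + α₃ + 4 * α₄) ≤ 1)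
    (hs₄ : 1024 * ((d : ℝ) + 1) * ((d : ℝ) + 4) * L ^ 2 * α₀ ≤ 1) (hs₅ : 32 * ((d : ℝ) + 1) ^ 2 * C6 d * L ^ 2 * α₀ ≤ 1)
    (hs₆ : 16 * d * C5' d * C6 d * (L : ℝ) ^ 2 * α₀ ≤ 1) :
    ∀ j ≤ k, ∀ z : Site d,
      DifferentiableOn ℂ (fun τ : ℂ => Cnl L U₀ u₁ j (lam + τ • lam₀) z) (closedBall (0 : ℂ) (α₄ / (2 * m))) := by
  intro j hj z τ hτ
  rw [mem_closedBall, dist_zero_right] at hτ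
  have hs : (0 : ℝ) ≤ ((L : ℝ) ^ k)⁻¹ := by positivity
  obtain ⟨ha, hb⟩ := line_mem_dom207 h119a h119b hm₀a hm₀b hm hs hτ
  have hfam : ∀ x, AnalyticAt ℂ (fun σ : ℂ => (lam + σ • lam₀) x) τ := fun x =>
    analyticAt_const.fun_add (analyticAt_id.fun_smul analyticAt_const)
  have hA := analyticAt_Cnl_family (Λ := fun σ : ℂ => lam + σ • lam₀) (t₀ := τ) hL hG hU hfam hα hα3 hα2 h52 ha hb hu₁
    hα₃ hα₃' hs₁ hs₂ hs₃ hs₄ hs₅ hs₆ j hj z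
  exact hA.differentiableAt.differentiableWithinAt

/-- **(1.124) FOR `C′_j(u₁, ·)`** (p. 97: «Using the analyticity properties of `C′(λ)`, the derivative above can be written as
`⟨(δ/δλ)C′(λ), λ₀⟩ = (1/2πi)∫_{|τ|=r} dτ (1/τ²) C′(λ + τλ₀)`. (1.124) Taking `r = (2max{|λ₀|, |Dλ₀|})⁻¹α₄` …»): for `λ` in the half-size
set (1.119) (`‖R(U₀(b))λ(b₊) − λ(b₋)‖ < ½α₄η`, `‖λ(x)‖ < ½α₄`, `η = L⁻ᵏ`), `λ₀` with `max{|λ₀|, |Dλ₀|} ≤ m`, `0 < m`, and `r = α₄/(2m)`: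
`⟨δC′_j(u₁, λ), λ₀⟩(z) = (2πi)⁻¹ ∮_{|τ|=r} τ⁻² C′_j(u₁, λ + τλ₀)(z) dτ` for all `j ≤ k`, `z` (the other data and the smallness as in
`analyticAt_Cnl_family`).  Mathlib's Cauchy formula for the first derivative on the closed disc (`differentiableOn_Cnl_line`).
[cite: Balaban1985RegularSpaces, (1.124) p.97] -/
theorem eq1124 {L : ℕ} (hL : 2 ≤ L) {G : Subgroup 𝔸ˣ} (hG : AvgClosed d L G) {U₀ : Site d → Fin d → 𝔸ˣ}
    (hU : ∀ x κ, U₀ x κ ∈ G) {k : ℕ} {lam lam₀ : Site d → 𝔸} {m : ℝ}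
    {u₁ : Site d → 𝔸ˣ} {α₀ α₃ α₄ : ℝ}
    (hα : 0 < α₀) (hα3 : C0 d * α₀ ≤ 1 / 3) (hα2 : 2 * α₀ ≤ c2' d L)
    (h52 : pdev U₀ < α₀ * (((L : ℝ) ^ k)⁻¹) ^ 2)
    (h119a : ∀ (x : Site d) (κ : Fin d), ‖cj (U₀ x κ) (lam (x + e κ)) - lam x‖ < α₄ / 2 * ((L : ℝ) ^ k)⁻¹)
    (h119b : ∀ x : Site d, ‖lam x‖ < α₄ / 2)
    (hm₀a : ∀ (x : Site d) (κ : Fin d), ‖cj (U₀ x κ) (lam₀ (x + e κ)) - lam₀ x‖ ≤ m * ((L : ℝ) ^ k)⁻¹)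
    (hm₀b : ∀ x : Site d, ‖lam₀ x‖ ≤ m) (hm : 0 < m)
    (hu₁ : InLambda L U₀ u₁ k α₃ (((L : ℝ) ^ k)⁻¹))
    (hα₃ : 0 ≤ α₃) (hα₃' : α₃ ≤ 1 / 50)
    (hs₁ : 40 * C6 d * α₄ ≤ 1) (hs₂ : 12000 * ((d : ℝ) + 1) * L * α₄ ≤ 1) (hs₃ : C4G d L * (α₀ + α₃ + 4 * α₄) ≤ 1)
    (hs₄ : 1024 * ((d : ℝ) + 1) * ((d : ℝ) + 4) * L ^ 2 * α₀ ≤ 1) (hs₅ : 32 * ((d : ℝ) + 1) ^ 2 * C6 d * L ^ 2 * α₀ ≤ 1)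
    (hs₆ : 16 * d * C5' d * C6 d * (L : ℝ) ^ 2 * α₀ ≤ 1) :
    ∀ j ≤ k, ∀ z : Site d,
      dCnl L U₀ u₁ j lam lam₀ z =
        (2 * π * Complex.I)⁻¹ • ∮ τ in C(0, α₄ / (2 * m)), (1 / τ ^ 2) • Cnl L U₀ u₁ j (lam + τ • lam₀) z := by
  intro j hj z
  have hα₄ : 0 < α₄ := by linarith [norm_nonneg (lam 0), h119b 0]
  have hr : 0 < α₄ / (2 * m) := by positivity
  have hd := differentiableOn_Cnl_line hL hG hU hα hα3 hα2 h52 h119a h119b hm₀a hm₀b hm hu₁ hα₃ hα₃' hs₁ hs₂ hs₃ hs₄ hs₅ hs₆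
    j hj z
  have h := hd.deriv_eq_smul_circleIntegral hr
  simp only [sub_zero] at h
  rw [dCnl, eq_comm, inv_smul_eq_iff₀ Complex.two_pi_I_ne_zero, ← h]

/-- **(1.125) FOR `C′_j(u₁, ·)`, sharp form** (p. 97: «we get the estimate `|⟨(δ/δλ)C′(λ), λ₀⟩| ≦ C′₂ 2max{|λ₀|, |Dλ₀|} (α₃ + α₄)`.
(1.125)»): under the data of `eq1124` with the smallness of (214) (`B8Eq178Averages.eq214_qprimeIter_of207`), for all `j ≤ k`, `z`:
`‖⟨δC′_j(u₁, λ), λ₀⟩(z)‖ ≤ C′₂·2m·(α₃ + α₄)·LʲL⁻ᵏ` — the abstract step `B8Ineq125.cauchy_weighted` BY NAME, its sphere bound `M =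
C′₂(α₃ + α₄)α₄·LʲL⁻ᵏ` being (1.121) = (214) at the points `λ + τλ₀`, `|τ| = α₄/(2m)`, which lie in (1.120) by `line_mem_dom207`.
[cite: Balaban1985RegularSpaces, (1.125) p.97, (1.121) p.96; Balaban1985Averaging, (214) p.50] -/
theorem ineq1125 {L : ℕ} (hL : 2 ≤ L) {G : Subgroup 𝔸ˣ} (hG : AvgClosed d L G) {U₀ : Site d → Fin d → 𝔸ˣ}
    (hU : ∀ x κ, U₀ x κ ∈ G) {k : ℕ} {lam lam₀ : Site d → 𝔸} {m : ℝ}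
    {u₁ : Site d → 𝔸ˣ} {α₀ α₃ α₄ : ℝ}
    (hα : 0 < α₀) (hα3 : C0 d * α₀ ≤ 1 / 3) (hα2 : 2 * α₀ ≤ c2' d L)
    (h52 : pdev U₀ < α₀ * (((L : ℝ) ^ k)⁻¹) ^ 2)
    (h119a : ∀ (x : Site d) (κ : Fin d), ‖cj (U₀ x κ) (lam (x + e κ)) - lam x‖ < α₄ / 2 * ((L : ℝ) ^ k)⁻¹)
    (h119b : ∀ x : Site d, ‖lam x‖ < α₄ / 2)
    (hm₀a : ∀ (x : Site d) (κ : Fin d), ‖cj (U₀ x κ) (lam₀ (x + e κ)) - lam₀ x‖ ≤ m * ((L : ℝ) ^ k)⁻¹)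
    (hm₀b : ∀ x : Site d, ‖lam₀ x‖ ≤ m) (hm : 0 < m)
    (hu₁ : InLambda L U₀ u₁ k α₃ (((L : ℝ) ^ k)⁻¹))
    (hα₃ : 0 ≤ α₃) (hα₃' : α₃ ≤ 1 / 200)
    (hs₁ : 200 * C6 d * α₄ ≤ 1) (hs₂ : 12000 * ((d : ℝ) + 1) * L * α₄ ≤ 1) (hs₃ : C4G d L * (α₀ + α₃ + 4 * α₄) ≤ 1)
    (hs₄ : 1024 * ((d : ℝ) + 1) * ((d : ℝ) + 4) * L ^ 2 * α₀ ≤ 1) (hs₅ : 32 * ((d : ℝ) + 1) ^ 2 * C6 d * L ^ 2 * α₀ ≤ 1)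
    (hs₆ : 16 * d * C5' d * C6 d * (L : ℝ) ^ 2 * α₀ ≤ 1) (hs₇ : 8 * d * C6 d * L * α₀ ≤ 1) :
    ∀ j ≤ k, ∀ z : Site d,
      ‖dCnl L U₀ u₁ j lam lam₀ z‖ ≤ C2p d * (2 * m) * (α₃ + α₄) * ((L : ℝ) ^ j * ((L : ℝ) ^ k)⁻¹) := by
  intro j hj z
  have hα₄ : 0 < α₄ := by linarith [norm_nonneg (lam 0), h119b 0]
  have hC6 : (2 : ℝ) ≤ C6 d := by unfold C6; linarith [one_le_C5 (d := d)]
  have hs₁' : 40 * C6 d * α₄ ≤ 1 := by nlinarith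
  have hα₃'' : α₃ ≤ 1 / 50 := hα₃'.trans (by norm_num)
  have hs : (0 : ℝ) ≤ ((L : ℝ) ^ k)⁻¹ := by positivity
  -- the `DiffContOnCl` input
  have hd := differentiableOn_Cnl_line hL hG hU hα hα3 hα2 h52 h119a h119b hm₀a hm₀b hm hu₁ hα₃ hα₃'' hs₁' hs₂ hs₃ hs₄ hs₅
    hs₆ j hj z
  have hdc : DiffContOnCl ℂ (fun τ : ℂ => Cnl L U₀ u₁ j (lam + τ • lam₀) z) (ball (0 : ℂ) (α₄ / (2 * m))) :=
    hd.diffContOnCl_ball (subset_refl _)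
  -- the sphere bound (1.121) from (214)
  have hM : ∀ τ ∈ sphere (0 : ℂ) (α₄ / (2 * m)),
      ‖Cnl L U₀ u₁ j (lam + τ • lam₀) z‖ ≤ 16 * Cgen d * (α₃ * α₄ + α₄ ^ 2) * ((L : ℝ) ^ j * ((L : ℝ) ^ k)⁻¹) := by
    intro τ hτ
    rw [mem_sphere, dist_zero_right] at hτ
    obtain ⟨ha, hb⟩ := line_mem_dom207 h119a h119b hm₀a hm₀b hm hs hτ.le
    exact eq214_qprimeIter_of207 hL hG hU hα hα3 hα2 h52 ha hb hu₁ hα₃ hα₃' hs₁ hs₂ hs₃ hs₄ hs₅ hs₆ hs₇ j hj z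
  have h := B8Ineq125.cauchy_weighted hm hα₄ hdc hM
  rw [dCnl]
  refine h.trans (le_of_eq ?_)
  rw [C2p, div_eq_iff hα₄.ne']
  ring

/-- **(1.125) AS DISPLAYED**: `‖⟨δC′_j(u₁, λ), λ₀⟩(z)‖ ≤ C′₂·2max{|λ₀|, |Dλ₀|}·(α₃ + α₄)` with `max{|λ₀|, |Dλ₀|} ≤ m` — `ineq1125` and
`LʲL⁻ᵏ ≤ 1` (`j ≤ k`; print drops the factor `Lʲη` of (214) already in (1.121)). [cite: Balaban1985RegularSpaces, (1.125) p.97] -/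
theorem ineq1125_printed {L : ℕ} (hL : 2 ≤ L) {G : Subgroup 𝔸ˣ} (hG : AvgClosed d L G) {U₀ : Site d → Fin d → 𝔸ˣ}
    (hU : ∀ x κ, U₀ x κ ∈ G) {k : ℕ} {lam lam₀ : Site d → 𝔸} {m : ℝ}
    {u₁ : Site d → 𝔸ˣ} {α₀ α₃ α₄ : ℝ}
    (hα : 0 < α₀) (hα3 : C0 d * α₀ ≤ 1 / 3) (hα2 : 2 * α₀ ≤ c2' d L)
    (h52 : pdev U₀ < α₀ * (((L : ℝ) ^ k)⁻¹) ^ 2)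
    (h119a : ∀ (x : Site d) (κ : Fin d), ‖cj (U₀ x κ) (lam (x + e κ)) - lam x‖ < α₄ / 2 * ((L : ℝ) ^ k)⁻¹)
    (h119b : ∀ x : Site d, ‖lam x‖ < α₄ / 2)
    (hm₀a : ∀ (x : Site d) (κ : Fin d), ‖cj (U₀ x κ) (lam₀ (x + e κ)) - lam₀ x‖ ≤ m * ((L : ℝ) ^ k)⁻¹)
    (hm₀b : ∀ x : Site d, ‖lam₀ x‖ ≤ m) (hm : 0 < m)
    (hu₁ : InLambda L U₀ u₁ k α₃ (((L : ℝ) ^ k)⁻¹))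
    (hα₃ : 0 ≤ α₃) (hα₃' : α₃ ≤ 1 / 200)
    (hs₁ : 200 * C6 d * α₄ ≤ 1) (hs₂ : 12000 * ((d : ℝ) + 1) * L * α₄ ≤ 1) (hs₃ : C4G d L * (α₀ + α₃ + 4 * α₄) ≤ 1)
    (hs₄ : 1024 * ((d : ℝ) + 1) * ((d : ℝ) + 4) * L ^ 2 * α₀ ≤ 1) (hs₅ : 32 * ((d : ℝ) + 1) ^ 2 * C6 d * L ^ 2 * α₀ ≤ 1)
    (hs₆ : 16 * d * C5' d * C6 d * (L : ℝ) ^ 2 * α₀ ≤ 1) (hs₇ : 8 * d * C6 d * L * α₀ ≤ 1) :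
    ∀ j ≤ k, ∀ z : Site d, ‖dCnl L U₀ u₁ j lam lam₀ z‖ ≤ C2p d * (2 * m) * (α₃ + α₄) := by
  intro j hj z
  have h := ineq1125 hL hG hU hα hα3 hα2 h52 h119a h119b hm₀a hm₀b hm hu₁ hα₃ hα₃' hs₁ hs₂ hs₃ hs₄ hs₅ hs₆ hs₇ j hj z
  have hα₄ : 0 < α₄ := by linarith [norm_nonneg (lam 0), h119b 0]
  have hLr : (1 : ℝ) ≤ L := by exact_mod_cast le_trans (by norm_num) hL
  have ht : (L : ℝ) ^ j * ((L : ℝ) ^ k)⁻¹ ≤ 1 := by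
    rw [← div_eq_mul_inv, div_le_one (by positivity)]
    exact pow_le_pow_right₀ hLr hj
  have h0 : 0 ≤ C2p d * (2 * m) * (α₃ + α₄) := by
    have := C2p_nonneg d; positivity
  calc _ ≤ _ := h
    _ ≤ C2p d * (2 * m) * (α₃ + α₄) * 1 := mul_le_mul_of_nonneg_left ht h0
    _ = C2p d * (2 * m) * (α₃ + α₄) := mul_one _

end Cauchy

end Literature.MathematicalPhysics.QuantumFieldTheory.Balaban1983to89.B8Ineq125Concrete

end
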